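import Mathlib

/-!
# Route RibetTakahashiSplit — item `DiscrepancyPotentialBound` (stmt-ABC-2637), part 1:
  counting and the empirical side

Helper lemmas for Serre's log-gas lemma
`Summit.ABC.ABC.Theses.RibetTakahashiSplit.DiscrepancyPotentialBound` (closed in
`RibetTakahashiSplitDiscrepancyPotentialBound.lean`).  The proof is a one-sided, discretised
layer-cake (Koksma-type) comparison.  With `M ≥ log (2L)`, `K ≥ 0`, `N ≥ 1`, `h = (M+K)/N` and the
geometric radii `e_k = exp (M - (k+1) h)` (`k < N`), the level step function
`ψ(t) = M - h · #{k < N : |a - t| ≤ e_k}` satisfies `log |a-t| ≤ ψ(t) ≤ max (log|a-t|) (-K) + h`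
for `0 < |a - t| ≤ 2L` (`log_le_level`, `level_le_max`, via the closed form `card_levels_eq`).
Summing over sample points gives `sum_log_le_counts`, and the discrepancy hypothesis applied to
the `N + 2` closed intervals `[-L, L]`, `[a, a]`, `[a - e_k, a + e_k]` gives
`avg_log_le_of_discrepancy`:
`(1/n) Σ_{xᵢ ≠ a} log|a - xᵢ| ≤ M ∫_{-L}^{L} ρ - h Σ_k ∫_{a-e_k}^{a+e_k} ρ + 2(M+K)δ`.
Everything here is elementary real arithmetic (no measure theory beyond the notation).
-/

-- `Summit.<Summit>.<Problem>` is the mandated summit-side namespace (CONVENTIONS §2); for the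
-- single-conjunct summit `ABC` the two coincide, so the duplicate `ABC.ABC` is deliberate.
set_option linter.dupNamespace false

open MeasureTheory Set intervalIntegral Real Finset

namespace Summit.ABC.ABC.Theorems

namespace DiscrepancyPotentialBound

/-- The number of levels `k < N` with `r ≤ exp (M - (k+1) h)` is `min N ⌊(M - log r)/h⌋₊`. -/
theorem card_levels_eq {M h r : ℝ} (N : ℕ) (hh : 0 < h) (hr : 0 < r) (hrM : Real.log r ≤ M) :
    ((Finset.range N).filter (fun k : ℕ => r ≤ Real.exp (M - ((k:ℝ) + 1) * h))).card
      = min N ⌊(M - Real.log r) / h⌋₊ := by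
  have hc : 0 ≤ (M - Real.log r) / h := div_nonneg (sub_nonneg.mpr hrM) hh.le
  have key : ∀ k : ℕ, (r ≤ Real.exp (M - ((k:ℝ) + 1) * h)) ↔ k < ⌊(M - Real.log r) / h⌋₊ := by
    intro k
    rw [← Real.log_le_iff_le_exp hr, ← Nat.add_one_le_iff, Nat.le_floor_iff hc,
      le_div_iff₀ hh]
    push_cast
    constructor <;> intro H <;> linarith
  rw [Finset.filter_congr (fun k _ => key k)]
  have hset : (Finset.range N).filter (fun k : ℕ => k < ⌊(M - Real.log r) / h⌋₊)
      = Finset.range (min N ⌊(M - Real.log r) / h⌋₊) := by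
    ext k
    simp [Finset.mem_range]
  rw [hset, Finset.card_range]

/-- Lower bound: the discretised level function dominates `log r`. -/
theorem log_le_level {M K h r : ℝ} {N : ℕ} (hN : 0 < N) (hh : h = (M + K) / N) (hMK : 0 < M + K)
    (hr : 0 < r) (hrM : Real.log r ≤ M) :
    Real.log r ≤
      M - h * ((Finset.range N).filter (fun k : ℕ => r ≤ Real.exp (M - ((k:ℝ) + 1) * h))).card := by
  have hN' : (0 : ℝ) < N := by exact_mod_cast hN
  have hpos : 0 < h := by rw [hh]; exact div_pos hMK hN'
  have hc : 0 ≤ (M - Real.log r) / h := div_nonneg (sub_nonneg.mpr hrM) hpos.le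
  rw [card_levels_eq N hpos hr hrM]
  have h1 : ((min N ⌊(M - Real.log r) / h⌋₊ : ℕ) : ℝ) ≤ (M - Real.log r) / h := by
    calc ((min N ⌊(M - Real.log r) / h⌋₊ : ℕ) : ℝ) ≤ (⌊(M - Real.log r) / h⌋₊ : ℝ) := by
          exact_mod_cast min_le_right _ _
      _ ≤ (M - Real.log r) / h := Nat.floor_le hc
  have h2 : h * ((min N ⌊(M - Real.log r) / h⌋₊ : ℕ) : ℝ) ≤ M - Real.log r := by
    calc h * ((min N ⌊(M - Real.log r) / h⌋₊ : ℕ) : ℝ) ≤ h * ((M - Real.log r) / h) :=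
          mul_le_mul_of_nonneg_left h1 hpos.le
      _ = M - Real.log r := by field_simp
  linarith

/-- Upper bound: the discretised level function is at most `max (log r) (-K) + h`. -/
theorem level_le_max {M K h r : ℝ} {N : ℕ} (hN : 0 < N) (hh : h = (M + K) / N) (hMK : 0 < M + K)
    (hr : 0 < r) (hrM : Real.log r ≤ M) :
    M - h * ((Finset.range N).filter (fun k : ℕ => r ≤ Real.exp (M - ((k:ℝ) + 1) * h))).card
      ≤ max (Real.log r) (-K) + h := by
  have hN' : (0 : ℝ) < N := by exact_mod_cast hN
  have hpos : 0 < h := by rw [hh]; exact div_pos hMK hN'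
  have hhN : h * N = M + K := by rw [hh]; field_simp
  have hc : 0 ≤ (M - Real.log r) / h := div_nonneg (sub_nonneg.mpr hrM) hpos.le
  rw [card_levels_eq N hpos hr hrM]
  rcases le_total N ⌊(M - Real.log r) / h⌋₊ with hle | hle
  · rw [min_eq_left hle]
    have : M - h * (N : ℝ) = -K := by linarith
    rw [this]
    linarith [le_max_right (Real.log r) (-K)]
  · rw [min_eq_right hle]
    have h1 : (M - Real.log r) / h < (⌊(M - Real.log r) / h⌋₊ : ℝ) + 1 := Nat.lt_floor_add_one _
    have h2 : M - Real.log r < h * (⌊(M - Real.log r) / h⌋₊ : ℝ) + h := by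
      have := mul_lt_mul_of_pos_left h1 hpos
      rw [mul_div_cancel₀ _ hpos.ne'] at this
      linarith
    linarith [le_max_left (Real.log r) (-K)]

/-- Membership in the symmetric interval is the distance condition. -/
theorem mem_Icc_sub_add_iff {a t e : ℝ} : t ∈ Set.Icc (a - e) (a + e) ↔ |a - t| ≤ e := by
  rw [Set.mem_Icc, abs_sub_le_iff]
  constructor <;> rintro ⟨h1, h2⟩ <;> constructor <;> linarith

/-- Combinatorial bound: the truncated-log sum is dominated by the level step function,
written through interval counts. -/
theorem sum_log_le_counts {n N : ℕ} {M K h : ℝ} (x : Fin n → ℝ) (a : ℝ)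
    (hN : 0 < N) (hh : h = (M + K) / N) (hMK : 0 < M + K)
    (hM : ∀ i, x i ≠ a → Real.log |a - x i| ≤ M) :
    (∑ i, if x i = a then (0:ℝ) else Real.log |a - x i|)
      ≤ n * M - h * ∑ k ∈ Finset.range N,
          ((Finset.univ.filter (fun i => x i ∈ Set.Icc (a - Real.exp (M - ((k:ℝ) + 1) * h))
            (a + Real.exp (M - ((k:ℝ) + 1) * h)))).card : ℝ)
        + K * ((Finset.univ.filter (fun i => x i ∈ Set.Icc a a)).card : ℝ) := by
  have hN' : (0 : ℝ) < N := by exact_mod_cast hN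
  have hhN : h * N = M + K := by rw [hh]; field_simp
  -- termwise majorant
  set G : Fin n → ℝ := fun i => M - h * (∑ k ∈ Finset.range N,
      (if x i ∈ Set.Icc (a - Real.exp (M - ((k:ℝ) + 1) * h)) (a + Real.exp (M - ((k:ℝ) + 1) * h))
        then (1:ℝ) else 0)) + K * (if x i ∈ Set.Icc a a then (1:ℝ) else 0) with hG
  have hterm : ∀ i, (if x i = a then (0:ℝ) else Real.log |a - x i|) ≤ G i := by
    intro i
    by_cases hi : x i = a
    · rw [if_pos hi, hG]
      simp only [hi]
      have hs : (∑ k ∈ Finset.range N,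
          (if a ∈ Set.Icc (a - Real.exp (M - ((k:ℝ) + 1) * h)) (a + Real.exp (M - ((k:ℝ) + 1) * h))
            then (1:ℝ) else 0)) = N := by
        rw [Finset.sum_congr rfl (fun k _ => if_pos (by
          rw [mem_Icc_sub_add_iff]; simp [(Real.exp_pos _).le]))]
        simp
      rw [hs]
      have ha : a ∈ Set.Icc a a := Set.left_mem_Icc.mpr le_rfl
      rw [if_pos ha]
      linarith
    · rw [if_neg hi, hG]
      simp only
      have hr : 0 < |a - x i| := abs_pos.mpr (sub_ne_zero.mpr (Ne.symm hi))
      have hnot : x i ∉ Set.Icc a a := by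
        intro hmem; exact hi (le_antisymm hmem.2 hmem.1)
      rw [if_neg hnot, mul_zero, add_zero]
      have hsum : (∑ k ∈ Finset.range N,
          (if x i ∈ Set.Icc (a - Real.exp (M - ((k:ℝ) + 1) * h))
              (a + Real.exp (M - ((k:ℝ) + 1) * h)) then (1:ℝ) else 0))
          = (((Finset.range N).filter
              (fun k : ℕ => |a - x i| ≤ Real.exp (M - ((k:ℝ) + 1) * h))).card : ℝ) := by
        rw [Finset.natCast_card_filter]
        refine Finset.sum_congr rfl (fun k _ => ?_)
        simp only [mem_Icc_sub_add_iff]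
      rw [hsum]
      exact log_le_level hN hh hMK hr (hM i hi)
  -- sum the majorant
  have hsumG : ∑ i, G i = n * M - h * ∑ k ∈ Finset.range N,
          ((Finset.univ.filter (fun i => x i ∈ Set.Icc (a - Real.exp (M - ((k:ℝ) + 1) * h))
            (a + Real.exp (M - ((k:ℝ) + 1) * h)))).card : ℝ)
        + K * ((Finset.univ.filter (fun i => x i ∈ Set.Icc a a)).card : ℝ) := by
    simp only [hG, Finset.sum_add_distrib, Finset.sum_sub_distrib, Finset.sum_const,
      Finset.card_univ, Fintype.card_fin, nsmul_eq_mul, ← Finset.mul_sum,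
      Finset.natCast_card_filter]
    rw [Finset.sum_comm]
  calc (∑ i, if x i = a then (0:ℝ) else Real.log |a - x i|) ≤ ∑ i, G i :=
        Finset.sum_le_sum (fun i _ => hterm i)
    _ = _ := hsumG

/-- Averaged bound after applying the discrepancy hypothesis to the `N + 2` intervals
`[-L, L]`, `[a, a]` and `[a - e_k, a + e_k]`. -/
theorem avg_log_le_of_discrepancy {n N : ℕ} {M K h L δ : ℝ} (ρ : ℝ → ℝ) (x : Fin n → ℝ) (a : ℝ)
    (hn : 0 < n) (hN : 0 < N) (hh : h = (M + K) / N) (hMK : 0 < M + K) (hK : 0 ≤ K)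
    (hM0 : 0 ≤ M) (hLM : Real.log (2 * L) ≤ M) (hx : ∀ i, |x i| ≤ L) (ha : |a| ≤ L)
    (hD : ∀ α β : ℝ, α ≤ β → |((Finset.univ.filter (fun i => x i ∈ Set.Icc α β)).card : ℝ) / n
      - ∫ t in α..β, ρ t| ≤ δ) :
    (∑ i, if x i = a then (0:ℝ) else Real.log |a - x i|) / n
      ≤ M * (∫ t in (-L)..L, ρ t)
        - h * (∑ k ∈ Finset.range N,
            ∫ t in (a - Real.exp (M - ((k:ℝ) + 1) * h))..(a + Real.exp (M - ((k:ℝ) + 1) * h)), ρ t)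
        + 2 * (M + K) * δ := by
  have hn' : (0:ℝ) < n := by exact_mod_cast hn
  have hN' : (0 : ℝ) < N := by exact_mod_cast hN
  have hpos : 0 < h := by rw [hh]; exact div_pos hMK hN'
  have hhN : h * N = M + K := by rw [hh]; field_simp
  -- the pointwise size bound `log |a - x i| ≤ M`
  have hM : ∀ i, x i ≠ a → Real.log |a - x i| ≤ M := by
    intro i hi
    have hr : 0 < |a - x i| := abs_pos.mpr (sub_ne_zero.mpr (Ne.symm hi))
    have h2L : |a - x i| ≤ 2 * L := by
      calc |a - x i| ≤ |a| + |x i| := abs_sub _ _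
        _ ≤ L + L := add_le_add ha (hx i)
        _ = 2 * L := by ring
    calc Real.log |a - x i| ≤ Real.log (2 * L) := Real.log_le_log hr h2L
      _ ≤ M := hLM
  have hS := sum_log_le_counts x a hN hh hMK hM
  -- abbreviations
  set cnt : ℕ → ℝ := fun k => ((Finset.univ.filter (fun i => x i ∈
      Set.Icc (a - Real.exp (M - ((k:ℝ) + 1) * h)) (a + Real.exp (M - ((k:ℝ) + 1) * h)))).card : ℝ)
    with hcnt
  set μ : ℕ → ℝ := fun k =>
      ∫ t in (a - Real.exp (M - ((k:ℝ) + 1) * h))..(a + Real.exp (M - ((k:ℝ) + 1) * h)), ρ t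
    with hμ
  set c0 : ℝ := ((Finset.univ.filter (fun i => x i ∈ Set.Icc a a)).card : ℝ) with hc0
  set IJ : ℝ := ∫ t in (-L)..L, ρ t with hIJ
  -- discrepancy consequences
  have h1 : (1:ℝ) ≤ IJ + δ := by
    have hL : -L ≤ L := by linarith [abs_nonneg a, ha]
    have hall : (Finset.univ.filter (fun i => x i ∈ Set.Icc (-L) L)) = Finset.univ := by
      apply Finset.filter_true_of_mem
      intro i _
      exact Set.mem_Icc.mpr (abs_le.mp (hx i))
    have := hD (-L) L hL
    rw [hall, Finset.card_univ, Fintype.card_fin, div_self hn'.ne'] at this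
    have := (abs_le.mp this).2
    linarith
  have h2 : ∀ k ∈ Finset.range N, n * (μ k - δ) ≤ cnt k := by
    intro k _
    have he : a - Real.exp (M - ((k:ℝ) + 1) * h) ≤ a + Real.exp (M - ((k:ℝ) + 1) * h) := by
      linarith [Real.exp_pos (M - ((k:ℝ) + 1) * h)]
    have := (abs_le.mp (hD _ _ he)).1
    have h' : μ k - δ ≤ cnt k / n := by simp only [hμ, hcnt]; linarith
    rwa [le_div_iff₀ hn', mul_comm] at h'
  have h3 : c0 ≤ n * δ := by
    have := (abs_le.mp (hD a a le_rfl)).2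
    rw [intervalIntegral.integral_same, sub_zero] at this
    have h' : c0 / n ≤ δ := by simp only [hc0]; exact this
    rwa [div_le_iff₀ hn', mul_comm] at h'
  have h2s : (n:ℝ) * (∑ k ∈ Finset.range N, μ k) - n * (N * δ) ≤ ∑ k ∈ Finset.range N, cnt k := by
    have := Finset.sum_le_sum h2
    rw [← Finset.mul_sum, Finset.sum_sub_distrib, Finset.sum_const, Finset.card_range,
      nsmul_eq_mul] at this
    linarith
  -- combine
  rw [div_le_iff₀ hn']
  have e1 : M * (n:ℝ) ≤ M * (n * (IJ + δ)) := by
    apply mul_le_mul_of_nonneg_left _ hM0; nlinarith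
  have e2 : h * ((n:ℝ) * (∑ k ∈ Finset.range N, μ k) - n * (N * δ))
      ≤ h * ∑ k ∈ Finset.range N, cnt k := mul_le_mul_of_nonneg_left h2s hpos.le
  have e3 : K * c0 ≤ K * (n * δ) := mul_le_mul_of_nonneg_left h3 hK
  have e4 : h * ((n:ℝ) * (N * δ)) = n * ((M + K) * δ) := by
    rw [← hhN]; ring
  have main : (∑ i, if x i = a then (0:ℝ) else Real.log |a - x i|)
      ≤ (M * IJ - h * ∑ k ∈ Finset.range N, μ k + 2 * (M + K) * δ) * n := by
    calc (∑ i, if x i = a then (0:ℝ) else Real.log |a - x i|)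
        ≤ n * M - h * ∑ k ∈ Finset.range N, cnt k + K * c0 := hS
      _ ≤ M * (n * (IJ + δ)) - h * ((n:ℝ) * (∑ k ∈ Finset.range N, μ k) - n * (N * δ))
          + K * (n * δ) := by linarith
      _ = (M * IJ - h * ∑ k ∈ Finset.range N, μ k + 2 * (M + K) * δ) * n := by
          have : h * ((n:ℝ) * (∑ k ∈ Finset.range N, μ k) - n * (N * δ))
              = n * (h * ∑ k ∈ Finset.range N, μ k) - n * ((M + K) * δ) := by
            rw [mul_sub, e4]; ring
          rw [this]; ring
  exact main


end DiscrepancyPotentialBound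

end Summit.ABC.ABC.Theorems
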